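import Literature.Computability.Complexity.StructuralPH
import Literature.Computability.Complexity.PRelSigmaPi
import Literature.Computability.Complexity.IterateFP
import Literature.Computability.Complexity.CircuitEval
import HarnessLib

/-!
# The Karp–Lipton theorem `NP ⊆ P/poly → PH = Σ₂ᵖ` (proof; trunk CplxCore, pnp.S15)

This file DISCHARGES (D-0014) the named fact `Literature.Computability.Complexity.karp_lipton` (`StructuralPH.lean`;
Karp–Lipton 1980, Thm. 6.1, in Sipser's `Σ₂ᵖ` form; Arora–Barak 2009, Thm. 6.19):
`Literature.Computability.Complexity.karp_lipton_holds`. With `StructuralPHProofs.kannan_of_karp_lipton` and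
`KannanLanguage.lean` it also completes Kannan's theorem (`Literature.Computability.Complexity.kannan`, pnp.S16).

## The printed argument and its formalisation

Arora–Barak, proof of Thm. 6.19: "to show `PH = Σ₂ᵖ` it suffices to show `Π₂ᵖ ⊆ Σ₂ᵖ`"; for
`L = {x | ∀ u ∃ v R(x, u, v)}` with `R` polynomial time: if `NP ⊆ P/poly` then, since the `∃ v`
part is an `NP` statement, polynomial-size circuits decide it and — by self-reducibility
(Thm. 2.18: search reduces to decision) — polynomial-size circuits *output* a certificate `v`;
so `x ∈ L ⇔ ∃` (circuits `W`) `∀ u : R(x, u, W(x, u))`, a `Σ₂ᵖ` statement, where soundness needs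
no check of `W` because a verified certificate is conclusive.

* Part A — **collapse**: `∃ᵖ·∃ᵖ·K ⊆ ∃ᵖ·K` by pairing the witnesses
  (`polyExists_polyExists_subset`, matrix `assocL⁻¹(…)`), hence `∃ᵖ·Σₖ₊₁ ⊆ Σₖ₊₁`
  (`polyExists_SigmaP_succ_subset`) and `Π₂ ⊆ Σ₂ → PH = Σ₂`
  (`PH_eq_SigmaP_two_of_PiP_two_subset`, Arora–Barak Thm. 5.4, by induction `Σₖ ⊆ Σ₂`).
* Part B — the **prefix-search language** `PrefixLang R q = {⟨x', v₀⟩ | ∃ v, |v₀v| ≤ q|x'| ∧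
  ⟨x', v₀v⟩ ∈ R}` of a verifier `R ∈ P` is in `NP` (`PrefixLang_mem_NP`).
* Part C — the **self-reduction loop** as an `FP` function: states `⟨⟨x', W⟩, v₀⟩`; one round
  (`roundFn`: keep `v₀` if `⟨x', v₀⟩ ∈ R`, else extend by `0` if the advice circuit for the query
  length — read off the list `W` by the polynomial-time list access `PRelSigPi.elemFn` and run by
  the evaluator `CircEval.evalFn` — accepts `⟨x', v₀0⟩`, else by `1`) is in `FP` (`condFn`,
  `pairFn`, `concatFn`) with additive growth `3`, so `q(|⟨x', W⟩|) + 1` rounds are in `FP`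
  (`extractFn_mem_FP`, `iterate_mem_FP`); with correct advice the loop ends in an accepting
  certificate of length `≤ q|x'|` whenever one exists (`iterate_roundFn_spec`, `extractFn_spec`:
  the invariant "`v₀` accepting, or `|v₀| =` round number and `v₀` extends to a certificate").
* Part D — the **`Σ₂` sentence** `SL = {x | ∃ W (|W| ≤ P₁|x|) ∀ u (|u| ≤ p|⟨x, W⟩|) :
  |u| ≤ p|x| → the extracted certificate of ⟨x, u⟩ is valid}` with a polynomial-time matrix
  (`MatL_mem_P`), `SL ∈ Σ₂ᵖ` (`SL_mem_SigmaP_two`), and `L = SL` for `L ∈ Π₂ᵖ`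
  (`PiP_two_subset_SigmaP_two`): completeness takes for `W` the list (`body`) of the descriptions
  (`CircEval.desc`) of the circuits deciding `PrefixLang R q` (from `NP ⊆ P/poly`) at all query
  lengths `≤ 2(2n + 2 + p n) + 3 + q(2n + 2 + p n)`, of total length `≤ P₁(n)`
  (`CircEval.length_desc_le`, `PRelSigPi.length_body_le`); soundness reads the valid certificate
  off the matrix.

Representation of the levels used: `Π₂ᵖ = ∀ᵖ·Σ₁ᵖ` and `Σ₁ᵖ = ∃ᵖ·coP` definitionally
(`PolyHierarchy.lean`), unfolded by `mem_polyForall_iff`; `coP`-membership is `P`-membership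
(`compl_mem_P_iff`).

## Main statements

* `KarpLipton.PH_eq_SigmaP_two_of_PiP_two_subset`: `Π₂ᵖ ⊆ Σ₂ᵖ → PH = Σ₂ᵖ`.
* `KarpLipton.PiP_two_subset_SigmaP_two`: `NP ⊆ P/poly → Π₂ᵖ ⊆ Σ₂ᵖ`.
* `KarpLipton.PH_eq_SigmaP_two_of_NP_subset_PPoly`, `Literature.Computability.Complexity.karp_lipton_holds`: the theorem.

## References

* R. M. Karp, R. J. Lipton, *Some connections between nonuniform and uniform complexity
  classes*, Proc. 12th STOC (1980) 302–309, Thm. 6.1 (with the `Σ₂ᵖ` improvement credited to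
  Sipser). doi:10.1145/800141.804678
* S. Arora, B. Barak, *Computational Complexity: A Modern Approach*, CUP 2009, Thm. 6.19
  (Karp–Lipton) and its proof, Thm. 2.18 (search-to-decision self-reducibility), Thm. 5.4
  (collapse of `PH`), Def. 5.3, Thm. 6.18 (circuit evaluation in `P`).
-/

namespace Literature.Computability.Complexity

namespace KarpLipton

open _root_.Computability Polynomial OracleCompose CircEval

/-! ### Part A: merging existential blocks and the collapse to `Σ₂ᵖ` -/

/-- Reassociation `⟨x, ⟨y₁, y₂⟩⟩ ↦ ⟨⟨x, y₁⟩, y₂⟩` (total, via the projections). [folklore] -/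
noncomputable def assocL : List Bool → List Bool :=
  pairFn (pairFn fstP (fstP ∘ sndP)) (sndP ∘ sndP)

/-- `assocL ⟨x, y⟩ = ⟨⟨x, y.1⟩, y.2⟩`. [folklore] -/
@[simp] theorem assocL_boolPair (x y : List Bool) :
    assocL (boolPair x y) = boolPair (boolPair x (fstP y)) (sndP y) := by
  simp [assocL]

/-- `assocL ∈ FP`. [folklore] -/
theorem assocL_mem_FP : assocL ∈ FP :=
  pairFn_mem_FP (pairFn_mem_FP fstP_mem_FP (comp_mem_FP fstP_mem_FP sndP_mem_FP))
    (comp_mem_FP sndP_mem_FP sndP_mem_FP)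

/-- **Two existential blocks merge into one** (`∃ᵖ·∃ᵖ·K ⊆ ∃ᵖ·K`) when `K` is closed under
polynomial-time preimages and under intersections with `P` languages: the witness pair
`⟨y₁, y₂⟩`, the matrix `assocL⁻¹(fst⁻¹ LenLe p₁ ⊓ LenLe p₂ ⊓ L₂)`.
[Arora–Barak 2009, Thm. 5.4 (proof: "merging quantifiers"), Remark 5.8] [cite: AroraBarakCC2009, Thm. 5.4] -/
theorem polyExists_polyExists_subset {K : Set (Language Bool)}
    (hK : ∀ ⦃L : Language Bool⦄, L ∈ K → ∀ ⦃g : List Bool → List Bool⦄, g ∈ FP → g ⁻¹' L ∈ K)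
    (hKP : ∀ ⦃L₁ L₂ : Language Bool⦄, L₁ ∈ Classes.P → L₂ ∈ K → L₁ ⊓ L₂ ∈ K) :
    polyExists (polyExists K) ⊆ polyExists K := by
  rintro L ⟨L₁, ⟨L₂, hL₂, p₂, hp₂⟩, p₁, hp₁⟩
  set M : Language Bool := (fstP ⁻¹' LenLe p₁) ⊓ (LenLe p₂ ⊓ L₂) with hM
  have hMK : M ∈ K :=
    hKP (preimage_mem_P (LenLe_mem_P p₁) fstP_mem_FP) (hKP (LenLe_mem_P p₂) hL₂)
  have hmemM : ∀ x y₁ y₂ : List Bool, boolPair (boolPair x y₁) y₂ ∈ M ↔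
      y₁.length ≤ p₁.eval x.length ∧ y₂.length ≤ p₂.eval (boolPair x y₁).length ∧
        boolPair (boolPair x y₁) y₂ ∈ L₂ := by
    intro x y₁ y₂
    change (fstP (boolPair (boolPair x y₁) y₂) ∈ LenLe p₁ ∧ (boolPair (boolPair x y₁) y₂ ∈ LenLe p₂ ∧ _)) ↔ _
    rw [fstP_boolPair, boolPair_mem_LenLe, boolPair_mem_LenLe]
    exact Iff.rfl
  refine ⟨assocL ⁻¹' M, hK hMK assocL_mem_FP, 2 * p₁ + 2 + p₂.comp (2 * X + 2 + p₁), fun x => ?_⟩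
  rw [hp₁ x]
  constructor
  · rintro ⟨y₁, hy₁, hy₁L⟩
    obtain ⟨y₂, hy₂, hy₂L⟩ := (hp₂ _).1 hy₁L
    refine ⟨boolPair y₁ y₂, ?_, ?_⟩
    · have hmono : p₂.eval (boolPair x y₁).length ≤ p₂.eval (2 * x.length + 2 + p₁.eval x.length) := by
        apply TM2Iter.eval_mono; simp only [length_boolPair]; omega
      simp only [length_boolPair, eval_add, eval_mul, eval_ofNat, eval_X, eval_comp]
      omega
    · change assocL (boolPair x (boolPair y₁ y₂)) ∈ M
      rw [assocL_boolPair, fstP_boolPair, sndP_boolPair, hmemM]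
      exact ⟨hy₁, hy₂, hy₂L⟩
  · rintro ⟨y, -, hy⟩
    change assocL (boolPair x y) ∈ M at hy
    rw [assocL_boolPair, hmemM] at hy
    exact ⟨fstP y, hy.1, (hp₂ _).2 ⟨sndP y, hy.2.1, hy.2.2⟩⟩

/-- `∃ᵖ·Σₖ₊₁ᵖ ⊆ Σₖ₊₁ᵖ`: the level `Σₖ₊₁ = ∃ᵖ·Πₖ` absorbs a further existential block.
[Arora–Barak 2009, Thm. 5.4 (proof)] [cite: AroraBarakCC2009, Thm. 5.4] -/
theorem polyExists_SigmaP_succ_subset (k : ℕ) : polyExists (SigmaP (k + 1)) ⊆ SigmaP (k + 1) := by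
  obtain ⟨hp, hi, hu⟩ := SigmaP_closure k
  have cop : ∀ ⦃L : Language Bool⦄, L ∈ co (SigmaP k) →
      ∀ ⦃g : List Bool → List Bool⦄, g ∈ FP → g ⁻¹' L ∈ co (SigmaP k) :=
    fun _ hL _ hg => preimage_mem_co hp hL hg
  have coi : ∀ ⦃L₁ L₂ : Language Bool⦄, L₁ ∈ Classes.P → L₂ ∈ co (SigmaP k) → L₁ ⊓ L₂ ∈ co (SigmaP k) :=
    fun _ _ h₁ h₂ => inter_P_mem_co hu h₁ h₂
  exact polyExists_polyExists_subset cop coi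

/-- **Collapse**: if `Π₂ᵖ ⊆ Σ₂ᵖ` then `PH = Σ₂ᵖ` (by induction `Σₖ ⊆ Σ₂` for all `k`:
`Σₖ₊₁ = ∃ᵖ·coΣₖ ⊆ ∃ᵖ·coΣ₂ = ∃ᵖ·Π₂ ⊆ ∃ᵖ·Σ₂ ⊆ Σ₂`). [Arora–Barak 2009, Thm. 5.4 ("if Σᵢ = Πᵢ then
PH = Σᵢ")] [cite: AroraBarakCC2009, Thm. 5.4] -/
theorem PH_eq_SigmaP_two_of_PiP_two_subset (h : PiP 2 ⊆ SigmaP 2) : PH = SigmaP 2 := by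
  refine Set.Subset.antisymm ?_ (SigmaP_subset_PH 2)
  have key : ∀ k, SigmaP k ⊆ SigmaP 2 := by
    intro k
    induction k with
    | zero => exact P_subset_SigmaP 2
    | succ k ih =>
      intro L hL
      have h1 : L ∈ polyExists (co (SigmaP 2)) := polyExists_mono (co_mono ih) hL
      exact polyExists_SigmaP_succ_subset 1 (polyExists_mono h h1)
  intro L hL
  obtain ⟨k, hk⟩ := Set.mem_iUnion.1 hL
  exact key k hk


/-! ### Part B: the prefix-search language of an `NP` verifier is in `NP` -/

section Prefix

variable (R : Language Bool) (q : Polynomial ℕ)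

/-- **Prefix search**: `⟨x', v₀⟩ ∈ PrefixLang R q` iff the partial certificate `v₀` extends to a
certificate `v₀ v` of `x'` for the verifier `R` within the length bound `q(|x'|)` — the `NP`
language queried by the self-reduction ("does some accepting certificate start with `v₀`?").
[Arora–Barak 2009, Thm. 6.19 (proof: circuits that output a satisfying assignment, via
self-reducibility, Thm. 2.18)] [cite: AroraBarakCC2009, Thm. 6.19] -/
def PrefixLang : Language Bool :=
  {w | ∃ v : List Bool, (sndP w ++ v).length ≤ q.eval (fstP w).length ∧ boolPair (fstP w) (sndP w ++ v) ∈ R}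

/-- Membership of a pair in `PrefixLang`. [folklore] -/
theorem boolPair_mem_PrefixLang (x' v₀ : List Bool) :
    boolPair x' v₀ ∈ PrefixLang R q ↔
      ∃ v : List Bool, (v₀ ++ v).length ≤ q.eval x'.length ∧ boolPair x' (v₀ ++ v) ∈ R := by
  change (∃ v : List Bool, (sndP (boolPair x' v₀) ++ v).length ≤ q.eval (fstP (boolPair x' v₀)).length ∧
    boolPair (fstP (boolPair x' v₀)) (sndP (boolPair x' v₀) ++ v) ∈ R) ↔ _
  rw [fstP_boolPair, sndP_boolPair]

/-- The glueing map `⟨⟨x', v₀⟩, v⟩ ↦ ⟨x', v₀ v⟩`. [folklore] -/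
noncomputable def glueFn : List Bool → List Bool :=
  pairFn (fstP ∘ fstP) (concatFn ∘ pairFn (sndP ∘ fstP) sndP)

/-- `glueFn ⟨w, v⟩ = ⟨w.1, w.2 v⟩`. [folklore] -/
@[simp] theorem glueFn_boolPair (w v : List Bool) :
    glueFn (boolPair w v) = boolPair (fstP w) (sndP w ++ v) := by
  simp [glueFn]

/-- `glueFn ∈ FP`. [folklore] -/
theorem glueFn_mem_FP : glueFn ∈ FP :=
  pairFn_mem_FP (comp_mem_FP fstP_mem_FP fstP_mem_FP)
    (comp_mem_FP concatFn_mem_FP (pairFn_mem_FP (comp_mem_FP sndP_mem_FP fstP_mem_FP) sndP_mem_FP))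

/-- **`PrefixLang R q ∈ NP`** for `R ∈ P`: guess the extension `v` (`|v| ≤ q|w|`), verify
`|v₀ v| ≤ q|x'|` and `⟨x', v₀ v⟩ ∈ R` on `glueFn ⟨w, v⟩`. [Arora–Barak 2009, Def. 2.1, Thm. 2.18]
[cite: AroraBarakCC2009, Thm. 6.19] -/
theorem PrefixLang_mem_NP (hR : R ∈ Classes.P) : PrefixLang R q ∈ Nondeterministic.NP := by
  refine ⟨glueFn ⁻¹' (LenLe q ⊓ R), preimage_mem_P (inter_mem_P (LenLe_mem_P q) hR) glueFn_mem_FP, q,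
    fun w => ?_⟩
  have hmem : ∀ v : List Bool, boolPair w v ∈ glueFn ⁻¹' (LenLe q ⊓ R) ↔
      (sndP w ++ v).length ≤ q.eval (fstP w).length ∧ boolPair (fstP w) (sndP w ++ v) ∈ R := fun v => by
    change glueFn (boolPair w v) ∈ LenLe q ∧ glueFn (boolPair w v) ∈ R ↔ _
    rw [glueFn_boolPair, boolPair_mem_LenLe]
  constructor
  · rintro ⟨v, hv, hvR⟩
    refine ⟨v, ?_, (hmem v).2 ⟨hv, hvR⟩⟩
    have h1 : q.eval (fstP w).length ≤ q.eval w.length := TM2Iter.eval_mono q (length_boolUnpair_fst_le w)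
    rw [List.length_append] at hv
    omega
  · rintro ⟨v, -, hv⟩
    exact ⟨v, ((hmem v).1 hv).1, ((hmem v).1 hv).2⟩

end Prefix

/-! ### Part C: extracting a certificate with advice circuits (the self-reduction loop) -/

section Extract

variable (R : Language Bool) (q : Polynomial ℕ)

/-- Appending a fixed bit: `snocFn b w = w b`. [folklore] -/
noncomputable def snocFn (b : Bool) : List Bool → List Bool :=
  concatFn ∘ pairFn id (fun _ => [b])

/-- `snocFn b w = w ++ [b]`. [folklore] -/
@[simp] theorem snocFn_apply (b : Bool) (w : List Bool) : snocFn b w = w ++ [b] := by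
  simp [snocFn]

/-- `snocFn b ∈ FP`. [folklore] -/
theorem snocFn_mem_FP (b : Bool) : snocFn b ∈ FP :=
  comp_mem_FP concatFn_mem_FP (pairFn_mem_FP id_mem_FP (const_mem_FP [b]))

/-- The `x'`-component of a state `⟨⟨x', W⟩, v₀⟩`. [folklore] -/
def xS : List Bool → List Bool := fstP ∘ fstP
/-- The advice component `W` of a state `⟨⟨x', W⟩, v₀⟩`. [folklore] -/
def wS : List Bool → List Bool := sndP ∘ fstP

/-- `xS ∈ FP`. [folklore] -/
theorem xS_mem_FP : xS ∈ FP := comp_mem_FP fstP_mem_FP fstP_mem_FP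
/-- `wS ∈ FP`. [folklore] -/
theorem wS_mem_FP : wS ∈ FP := comp_mem_FP sndP_mem_FP fstP_mem_FP

/-- `xS` reads `x'`. [folklore] -/
@[simp] theorem xS_apply (x' W v₀ : List Bool) : xS (boolPair (boolPair x' W) v₀) = x' := by simp [xS]
/-- `wS` reads `W`. [folklore] -/
@[simp] theorem wS_apply (x' W v₀ : List Bool) : wS (boolPair (boolPair x' W) v₀) = W := by simp [wS]

/-- The next query `⟨x', v₀ 0⟩` of a state. [cite: AroraBarakCC2009, Thm. 6.19] -/
noncomputable def queryFn : List Bool → List Bool :=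
  pairFn xS (snocFn false ∘ sndP)

/-- `queryFn ⟨⟨x', W⟩, v₀⟩ = ⟨x', v₀ 0⟩`. [folklore] -/
@[simp] theorem queryFn_apply (x' W v₀ : List Bool) :
    queryFn (boolPair (boolPair x' W) v₀) = boolPair x' (v₀ ++ [false]) := by
  simp [queryFn]

/-- `queryFn ∈ FP`. [folklore] -/
theorem queryFn_mem_FP : queryFn ∈ FP :=
  pairFn_mem_FP xS_mem_FP (comp_mem_FP (snocFn_mem_FP false) sndP_mem_FP)

/-- **The advice answer**: the circuit description stored in `W` for the length of the query `Q`
(list access `elemFn ⟨Q, W⟩ = W_{|Q|}`) accepts `Q`. [cite: AroraBarakCC2009, Thm. 6.19] -/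
def Answer (W Q : List Bool) : Prop :=
  evalFn (boolPair Q (PRelSigPi.elemFn (boolPair Q W))) = [true]

/-- The states whose next query is answered `yes` by the advice. [folklore] -/
def AnsYes : Language Bool :=
  {z | Answer (wS z) (queryFn z)}

/-- `AnsYes ∈ P` (circuit evaluation and list access are polynomial time). [cite: AroraBarakCC2009, Thm. 6.18] -/
theorem AnsYes_mem_P : AnsYes ∈ Classes.P := by
  have h : AnsYes = pairFn queryFn (PRelSigPi.elemFn ∘ pairFn queryFn wS) ⁻¹' EvalLang :=
    Set.ext fun z => by
      change Answer (wS z) (queryFn z) ↔ evalFn (pairFn queryFn (PRelSigPi.elemFn ∘ pairFn queryFn wS) z) = [true]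
      rw [pairFn_apply, Function.comp_apply, pairFn_apply]
      rfl
  rw [h]
  exact preimage_mem_P EvalLang_mem_P
    (pairFn_mem_FP queryFn_mem_FP (comp_mem_FP PRelSigPi.elemFn_mem_FP (pairFn_mem_FP queryFn_mem_FP wS_mem_FP)))

/-- The states `⟨⟨x', W⟩, v₀⟩` whose partial certificate is already accepting: `⟨x', v₀⟩ ∈ R`. [folklore] -/
def Done : Language Bool :=
  {z | boolPair (xS z) (sndP z) ∈ R}

/-- `Done R ∈ P` for `R ∈ P`. [folklore] -/
theorem Done_mem_P (hR : R ∈ Classes.P) : Done R ∈ Classes.P := by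
  have h : Done R = pairFn xS sndP ⁻¹' R :=
    Set.ext fun z => by
      change boolPair (xS z) (sndP z) ∈ R ↔ pairFn xS sndP z ∈ R
      rw [pairFn_apply]
  rw [h]
  exact preimage_mem_P hR (pairFn_mem_FP xS_mem_FP sndP_mem_FP)

/-- Extending the partial certificate of a state by the bit `b`. [folklore] -/
noncomputable def extendFn (b : Bool) : List Bool → List Bool :=
  pairFn fstP (snocFn b ∘ sndP)

/-- `extendFn b ⟨s, v₀⟩ = ⟨s, v₀ b⟩`. [folklore] -/
@[simp] theorem extendFn_boolPair (b : Bool) (s v₀ : List Bool) :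
    extendFn b (boolPair s v₀) = boolPair s (v₀ ++ [b]) := by
  simp [extendFn]

/-- `extendFn b ∈ FP`. [folklore] -/
theorem extendFn_mem_FP (b : Bool) : extendFn b ∈ FP :=
  pairFn_mem_FP fstP_mem_FP (comp_mem_FP (snocFn_mem_FP b) sndP_mem_FP)

/-- `extendFn` lengthens by at most `3` (exactly `1` on well-formed pairs). [folklore] -/
theorem length_extendFn_le (b : Bool) (z : List Bool) : (extendFn b z).length ≤ z.length + 3 := by
  have h := length_boolUnpair_parts_le z
  simp only [extendFn, pairFn_apply, Function.comp_apply, snocFn_apply, length_boolPair,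
    List.length_append, List.length_singleton, fstP, sndP]
  omega

/-- **One round of the self-reduction**: keep an accepting partial certificate; otherwise extend
it by `0` if the advice says the extension `v₀ 0` still has an accepting completion, else by `1`.
[Arora–Barak 2009, Thm. 6.19 (proof), Thm. 2.18 (search-to-decision)] [cite: AroraBarakCC2009, Thm. 6.19] -/
noncomputable def roundFn : List Bool → List Bool :=
  condFn (Done R) id (condFn AnsYes (extendFn false) (extendFn true))

/-- `roundFn R ∈ FP` for `R ∈ P`. [cite: AroraBarakCC2009, Thm. 6.19] -/
theorem roundFn_mem_FP (hR : R ∈ Classes.P) : roundFn R ∈ FP :=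
  condFn_mem_FP (Done_mem_P R hR) id_mem_FP
    (condFn_mem_FP AnsYes_mem_P (extendFn_mem_FP false) (extendFn_mem_FP true))

/-- A round lengthens the state by at most `3`. [folklore] -/
theorem length_roundFn_le (z : List Bool) : (roundFn R z).length ≤ z.length + 3 := by
  rw [roundFn, condFn_apply]
  split_ifs
  · simp
  · rw [condFn_apply]
    split_ifs
    · exact length_extendFn_le false z
    · exact length_extendFn_le true z

/-- Membership of a well-formed state in `Done`. [folklore] -/
theorem boolPair_mem_Done (x' W v₀ : List Bool) :
    boolPair (boolPair x' W) v₀ ∈ Done R ↔ boolPair x' v₀ ∈ R := by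
  change boolPair (xS (boolPair (boolPair x' W) v₀)) (sndP (boolPair (boolPair x' W) v₀)) ∈ R ↔ _
  rw [xS_apply, sndP_boolPair]

/-- Membership of a well-formed state in `AnsYes`. [folklore] -/
theorem boolPair_mem_AnsYes (x' W v₀ : List Bool) :
    boolPair (boolPair x' W) v₀ ∈ AnsYes ↔ Answer W (boolPair x' (v₀ ++ [false])) := by
  change Answer (wS (boolPair (boolPair x' W) v₀)) (queryFn (boolPair (boolPair x' W) v₀)) ↔ _
  rw [wS_apply, queryFn_apply]

/-- A round keeps an accepting state. [folklore] -/
theorem roundFn_of_done {x' W v₀ : List Bool} (h : boolPair x' v₀ ∈ R) :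
    roundFn R (boolPair (boolPair x' W) v₀) = boolPair (boolPair x' W) v₀ := by
  rw [roundFn, condFn_of_mem _ _ ((boolPair_mem_Done R x' W v₀).2 h)]
  rfl

/-- A round extends by `0` on a `yes` answer. [folklore] -/
theorem roundFn_of_yes {x' W v₀ : List Bool} (h : boolPair x' v₀ ∉ R)
    (hA : Answer W (boolPair x' (v₀ ++ [false]))) :
    roundFn R (boolPair (boolPair x' W) v₀) = boolPair (boolPair x' W) (v₀ ++ [false]) := by
  rw [roundFn, condFn_of_not_mem _ _ (fun h' => h ((boolPair_mem_Done R x' W v₀).1 h')),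
    condFn_of_mem _ _ ((boolPair_mem_AnsYes x' W v₀).2 hA), extendFn_boolPair]

/-- A round extends by `1` on a `no` answer. [folklore] -/
theorem roundFn_of_no {x' W v₀ : List Bool} (h : boolPair x' v₀ ∉ R)
    (hA : ¬ Answer W (boolPair x' (v₀ ++ [false]))) :
    roundFn R (boolPair (boolPair x' W) v₀) = boolPair (boolPair x' W) (v₀ ++ [true]) := by
  rw [roundFn, condFn_of_not_mem _ _ (fun h' => h ((boolPair_mem_Done R x' W v₀).1 h')),
    condFn_of_not_mem _ _ (fun h' => hA ((boolPair_mem_AnsYes x' W v₀).1 h')), extendFn_boolPair]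

/-- **The extraction** run for `q(|⟨x', W⟩|) + 1 ≥ q(|x'|) + 1` rounds. [cite: AroraBarakCC2009, Thm. 6.19] -/
noncomputable def extractFn : List Bool → List Bool :=
  fun z => (roundFn R)^[(q + 1).eval (boolUnpair z).1.length] z

/-- `extractFn R q ∈ FP` (polynomially many rounds of an `FP` round function with additive growth,
`iterate_mem_FP`). [cite: AroraBarakCC2009, Thm. 6.19] -/
theorem extractFn_mem_FP (hR : R ∈ Classes.P) : extractFn R q ∈ FP :=
  iterate_mem_FP (roundFn_mem_FP R hR) 3 (length_roundFn_le R) (q + 1)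

/-- **Invariant of the self-reduction.** If the advice answers all queries `⟨x', v⟩` with
`|v| ≤ q|x'|` correctly (as membership in `PrefixLang R q`) and `x'` has some certificate, then
after `t` rounds from `⟨⟨x', W⟩, ε⟩` the state is `⟨⟨x', W⟩, v₀⟩` with `|v₀| ≤ q|x'|` and either
`⟨x', v₀⟩ ∈ R` already, or `|v₀| = t` and `v₀` still extends to a certificate.
[Arora–Barak 2009, Thm. 2.18 (proof), Thm. 6.19 (proof)] [cite: AroraBarakCC2009, Thm. 6.19] -/
theorem iterate_roundFn_spec (x' W : List Bool)
    (hW : ∀ v : List Bool, v.length ≤ q.eval x'.length →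
      (Answer W (boolPair x' v) ↔ boolPair x' v ∈ PrefixLang R q))
    (h0 : boolPair x' [] ∈ PrefixLang R q) (t : ℕ) :
    ∃ v₀ : List Bool, (roundFn R)^[t] (boolPair (boolPair x' W) []) = boolPair (boolPair x' W) v₀ ∧
      v₀.length ≤ q.eval x'.length ∧
      (boolPair x' v₀ ∈ R ∨ (v₀.length = t ∧ boolPair x' v₀ ∈ PrefixLang R q)) := by
  induction t with
  | zero =>
    refine ⟨[], rfl, by simp, Or.inr ⟨rfl, h0⟩⟩
  | succ t ih =>
    obtain ⟨v₀, hz, hlen, hcase⟩ := ih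
    rw [Function.iterate_succ_apply', hz]
    by_cases hDone : boolPair x' v₀ ∈ R
    · rw [roundFn_of_done R hDone]
      exact ⟨v₀, rfl, hlen, Or.inl hDone⟩
    rcases hcase with hR | ⟨hvt, hpre⟩
    · exact absurd hR hDone
    -- `v₀` is not accepting but extends: the extension is non-empty
    obtain ⟨v, hv, hvR⟩ := (boolPair_mem_PrefixLang R q x' v₀).1 hpre
    obtain ⟨b, v', rfl⟩ : ∃ b v', v = b :: v' := by
      cases v with
      | nil => rw [List.append_nil] at hvR; exact absurd hvR hDone
      | cons b v' => exact ⟨b, v', rfl⟩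
    have hlen1 : (v₀ ++ [false]).length ≤ q.eval x'.length := by
      simp only [List.length_append, List.length_cons, List.length_nil] at hv ⊢; omega
    by_cases hAns : Answer W (boolPair x' (v₀ ++ [false]))
    · rw [roundFn_of_yes R hDone hAns]
      refine ⟨v₀ ++ [false], rfl, hlen1, Or.inr ⟨by simp [hvt], (hW _ hlen1).1 hAns⟩⟩
    · rw [roundFn_of_no R hDone hAns]
      have hnot : boolPair x' (v₀ ++ [false]) ∉ PrefixLang R q := fun h => hAns ((hW _ hlen1).2 h)
      -- hence the accepting extension starts with `1`
      have hb : b = true := by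
        cases b
        · exact absurd ((boolPair_mem_PrefixLang R q x' _).2
            ⟨v', by simpa using hv, by simpa using hvR⟩) hnot
        · rfl
      subst hb
      refine ⟨v₀ ++ [true], rfl, by simpa using hlen1, Or.inr ⟨by simp [hvt], ?_⟩⟩
      exact (boolPair_mem_PrefixLang R q x' _).2 ⟨v', by simpa using hv, by simpa using hvR⟩

/-- **The extraction finds a certificate**: with correct advice, if `x'` has a certificate then the
final state `⟨⟨x', W⟩, v⟩` of `extractFn` has `|v| ≤ q|x'|` and `⟨x', v⟩ ∈ R`.
[cite: AroraBarakCC2009, Thm. 6.19] -/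
theorem extractFn_spec (x' W : List Bool)
    (hW : ∀ v : List Bool, v.length ≤ q.eval x'.length →
      (Answer W (boolPair x' v) ↔ boolPair x' v ∈ PrefixLang R q))
    (h0 : boolPair x' [] ∈ PrefixLang R q) :
    ∃ v : List Bool, extractFn R q (boolPair (boolPair x' W) []) = boolPair (boolPair x' W) v ∧
      v.length ≤ q.eval x'.length ∧ boolPair x' v ∈ R := by
  set t := (q + 1).eval (boolUnpair (boolPair (boolPair x' W) [])).1.length with ht
  obtain ⟨v₀, hz, hlen, hcase⟩ := iterate_roundFn_spec R q x' W hW h0 t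
  refine ⟨v₀, hz, hlen, ?_⟩
  rcases hcase with h | ⟨hvt, -⟩
  · exact h
  · exfalso
    have h1 : q.eval x'.length + 1 ≤ t := by
      rw [ht, boolUnpair_boolPair]
      have := TM2Iter.eval_mono (q + 1) (show x'.length ≤ (boolPair x' W).length by simp; omega)
      simpa using this
    omega

end Extract


/-! ### Part D: `Π₂ᵖ ⊆ Σ₂ᵖ` under `NP ⊆ P/poly`, and the theorem -/

section SigmaTwo

variable (R : Language Bool) (q p : Polynomial ℕ)

/-- `x` of `y = ⟨⟨x, W⟩, u⟩`. [folklore] -/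
def xY : List Bool → List Bool := fstP ∘ fstP
/-- `W` of `y = ⟨⟨x, W⟩, u⟩`. [folklore] -/
def wY : List Bool → List Bool := sndP ∘ fstP

/-- `xY ∈ FP`. [folklore] -/
theorem xY_mem_FP : xY ∈ FP := comp_mem_FP fstP_mem_FP fstP_mem_FP
/-- `wY ∈ FP`. [folklore] -/
theorem wY_mem_FP : wY ∈ FP := comp_mem_FP sndP_mem_FP fstP_mem_FP

/-- The instance `x' = ⟨x, u⟩` of `y = ⟨⟨x, W⟩, u⟩`. [folklore] -/
noncomputable def instFn : List Bool → List Bool := pairFn xY sndP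
/-- The initial state `⟨⟨x', W⟩, ε⟩` of `y = ⟨⟨x, W⟩, u⟩`. [folklore] -/
noncomputable def initFn : List Bool → List Bool := pairFn (pairFn instFn wY) (fun _ => [])
/-- The extracted certificate of `y = ⟨⟨x, W⟩, u⟩`. [cite: AroraBarakCC2009, Thm. 6.19] -/
noncomputable def certFn : List Bool → List Bool := sndP ∘ extractFn R q ∘ initFn

/-- `instFn ∈ FP`. [folklore] -/
theorem instFn_mem_FP : instFn ∈ FP := pairFn_mem_FP xY_mem_FP sndP_mem_FP
/-- `initFn ∈ FP`. [folklore] -/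
theorem initFn_mem_FP : initFn ∈ FP :=
  pairFn_mem_FP (pairFn_mem_FP instFn_mem_FP wY_mem_FP) (const_mem_FP [])
/-- `certFn R q ∈ FP` for `R ∈ P`. [cite: AroraBarakCC2009, Thm. 6.19] -/
theorem certFn_mem_FP (hR : R ∈ Classes.P) : certFn R q ∈ FP :=
  comp_mem_FP sndP_mem_FP (comp_mem_FP (extractFn_mem_FP R q hR) initFn_mem_FP)

variable (x W u : List Bool)

/-- `xY` reads `x`. [folklore] -/
@[simp] theorem xY_apply : xY (boolPair (boolPair x W) u) = x := by simp [xY]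
/-- `wY` reads `W`. [folklore] -/
@[simp] theorem wY_apply : wY (boolPair (boolPair x W) u) = W := by simp [wY]
/-- `instFn` builds `⟨x, u⟩`. [folklore] -/
@[simp] theorem instFn_apply : instFn (boolPair (boolPair x W) u) = boolPair x u := by simp [instFn]
/-- `initFn` builds `⟨⟨⟨x, u⟩, W⟩, ε⟩`. [folklore] -/
@[simp] theorem initFn_apply :
    initFn (boolPair (boolPair x W) u) = boolPair (boolPair (boolPair x u) W) [] := by simp [initFn]
/-- `certFn` is the certificate component of the extraction from the initial state. [folklore] -/
theorem certFn_apply :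
    certFn R q (boolPair (boolPair x W) u) = sndP (extractFn R q (boolPair (boolPair (boolPair x u) W) [])) := by
  simp [certFn]

/-- **The `Σ₂` matrix**: if `|u| ≤ p|x|` then the extracted certificate is a valid certificate of
`x' = ⟨x, u⟩` (`|v| ≤ q|x'|` and `⟨x', v⟩ ∈ R`). [cite: AroraBarakCC2009, Thm. 6.19] -/
def MatL : Language Bool :=
  {y | (sndP y).length ≤ p.eval (xY y).length →
    ((certFn R q y).length ≤ q.eval (instFn y).length ∧ boolPair (instFn y) (certFn R q y) ∈ R)}

/-- Length test between two computed strings is in `P`. [cite: AroraBarakCC2009, §1.3] -/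
theorem setOf_length_le_mem_P {f g : List Bool → List Bool} (hf : f ∈ FP) (hg : g ∈ FP) (r : Polynomial ℕ) :
    ({w | (g w).length ≤ r.eval (f w).length} : Language Bool) ∈ Classes.P := by
  have h : ({w | (g w).length ≤ r.eval (f w).length} : Language Bool) = pairFn f g ⁻¹' LenLe r :=
    Set.ext fun w => by
      change (g w).length ≤ r.eval (f w).length ↔ pairFn f g w ∈ LenLe r
      rw [pairFn_apply, boolPair_mem_LenLe]
  rw [h]
  exact preimage_mem_P (LenLe_mem_P r) (pairFn_mem_FP hf hg)

/-- Membership test of a computed pair is in `P`. [cite: AroraBarakCC2009, §1.3] -/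
theorem setOf_boolPair_mem_mem_P {f g : List Bool → List Bool} (hf : f ∈ FP) (hg : g ∈ FP)
    {S : Language Bool} (hS : S ∈ Classes.P) : ({w | boolPair (f w) (g w) ∈ S} : Language Bool) ∈ Classes.P := by
  have h : ({w | boolPair (f w) (g w) ∈ S} : Language Bool) = pairFn f g ⁻¹' S :=
    Set.ext fun w => by
      change boolPair (f w) (g w) ∈ S ↔ pairFn f g w ∈ S
      rw [pairFn_apply]
  rw [h]
  exact preimage_mem_P hS (pairFn_mem_FP hf hg)

/-- **`MatL ∈ P`.** [cite: AroraBarakCC2009, Thm. 6.19] -/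
theorem MatL_mem_P (hR : R ∈ Classes.P) : MatL R q p ∈ Classes.P := by
  have h : MatL R q p = {y | (sndP y).length ≤ p.eval (xY y).length}ᶜ ⊔
      ({y | (certFn R q y).length ≤ q.eval (instFn y).length} ⊓ {y | boolPair (instFn y) (certFn R q y) ∈ R}) :=
    Set.ext fun y => show (_ → _ ∧ _) ↔ (¬ _ ∨ (_ ∧ _)) by tauto
  rw [h]
  exact union_mem_P (compl_mem_P_iff.2 (setOf_length_le_mem_P xY_mem_FP sndP_mem_FP p))
    (inter_mem_P (setOf_length_le_mem_P instFn_mem_FP (certFn_mem_FP R q hR) q)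
      (setOf_boolPair_mem_mem_P instFn_mem_FP (certFn_mem_FP R q hR) hR))

/-- The `Π₁` level: all challenges `u` pass the matrix. [cite: AroraBarakCC2009, Thm. 6.19] -/
def BL : Language Bool :=
  {s | ∀ u : List Bool, u.length ≤ p.eval s.length → boolPair s u ∈ MatL R q p}

/-- `BL ∈ Π₁ᵖ`. [cite: AroraBarakCC2009, Def. 5.3] -/
theorem BL_mem_PiP_one (hR : R ∈ Classes.P) : BL R q p ∈ PiP 1 := by
  change BL R q p ∈ polyForall (SigmaP 0)
  exact mem_polyForall_iff.2 ⟨MatL R q p, MatL_mem_P R q p hR, p, fun s => Iff.rfl⟩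

/-- The `Σ₂` sentence: some advice `W` of length `≤ P₁|x|` passes all challenges.
[cite: AroraBarakCC2009, Thm. 6.19] -/
def SL (P₁ : Polynomial ℕ) : Language Bool :=
  {x | ∃ W : List Bool, W.length ≤ P₁.eval x.length ∧ boolPair x W ∈ BL R q p}

/-- `SL ∈ Σ₂ᵖ`. [cite: AroraBarakCC2009, Def. 5.3] -/
theorem SL_mem_SigmaP_two (hR : R ∈ Classes.P) (P₁ : Polynomial ℕ) : SL R q p P₁ ∈ SigmaP 2 := by
  change SL R q p P₁ ∈ polyExists (PiP 1)
  exact ⟨BL R q p, BL_mem_PiP_one R q p hR, P₁, fun s => Iff.rfl⟩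

end SigmaTwo

/-- Reading a list given as `List.ofFn f` inside its range. [folklore] -/
theorem getD_ofFn {α : Type} {m : ℕ} (f : Fin m → α) (d : α) {i : ℕ} (hi : i < m) :
    (List.ofFn f).getD i d = f ⟨i, hi⟩ := by
  simp [List.getD_eq_getElem?_getD, hi]

/-- **`Π₂ᵖ ⊆ Σ₂ᵖ` if `NP ⊆ P/poly`** (Karp–Lipton 1980; Arora–Barak 2009, Thm. 6.19, the heart of
the proof). For `L = {x | ∀ u ∃ v R}`: the prefix-search language of the verifier is in `NP`, hence
has polynomial-size circuits; guess (∃) the descriptions `W` of these circuits for all query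
lengths, and for every (∀) `u` extract a certificate by self-reduction and verify it — a
polynomial-time matrix, and no check of the guessed circuits is needed since a verified certificate
is conclusive. [cite: KarpLipton1980, Thm. 6.1] -/
theorem PiP_two_subset_SigmaP_two (hNP : Nondeterministic.NP ⊆ PPoly) : PiP 2 ⊆ SigmaP 2 := by
  intro L hL
  obtain ⟨E, hE, p, hp⟩ := mem_polyForall_iff.1 (show L ∈ polyForall (SigmaP 1) from hL)
  obtain ⟨R, hRco, q, hq⟩ := (show E ∈ polyExists (co (SigmaP 0)) from hE)
  have hR : R ∈ Classes.P := compl_mem_P_iff.1 hRco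
  -- circuits for the prefix-search language
  have hA : PrefixLang R q ∈ PPoly := hNP (PrefixLang_mem_NP R q hR)
  obtain ⟨s, C, hC, hdec⟩ : ∃ s : Polynomial ℕ, ∃ C : CircuitFamily,
      (∀ n, (C n).IsOver B2 ∧ (C n).size ≤ s.eval n) ∧ C.Decides (PrefixLang R q) := by
    simpa [PPoly, SIZE] using hA
  have har : ∀ n, ∀ g ∈ (C n).gates, g.arity ≤ 2 := fun n g hg => (hC n).1 g hg
  -- the advice: descriptions of the circuits for all query lengths `≤ Nmax |x|`
  set Nm : Polynomial ℕ := 2 * (2 * X + 2 + p) + 3 + q.comp (2 * X + 2 + p) with hNm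
  set Dm : Polynomial ℕ := (s.comp Nm + 1) * (8 * (Nm + s.comp Nm) + 10) with hDm
  set P₁ : Polynomial ℕ := (Nm + 1) * (2 * Dm + 2) with hP₁
  suffices hLS : L = SL R q p P₁ by rw [hLS]; exact SL_mem_SigmaP_two R q p hR P₁
  ext x
  constructor
  · -- completeness: the genuine descriptions as advice
    intro hx
    set N := Nm.eval x.length with hN
    let ds : List (List Bool) := List.ofFn fun i : Fin (N + 1) => desc (C i)
    set W := body ds with hW
    have hNval : N = 2 * (2 * x.length + 2 + p.eval x.length) + 3 +
        q.eval (2 * x.length + 2 + p.eval x.length) := by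
      simp [hN, hNm, eval_comp]
    -- the advice answers all short queries correctly
    have hAns : ∀ Q : List Bool, Q.length ≤ N → (Answer W Q ↔ Q ∈ PrefixLang R q) := by
      intro Q hQ
      have hel : PRelSigPi.elemFn (boolPair Q W) = desc (C Q.length) := by
        rw [hW, PRelSigPi.elemFn_boolPair_body, getD_ofFn _ _ (Nat.lt_succ_of_le hQ)]
      rw [Answer, hel, evalFn_boolPair_desc Q (C Q.length) (har Q.length), hdec Q, List.cons.injEq]
      simp only [and_true]
      exact (Set.mem_iff_boolIndicator _ _).symm
    -- the advice is short
    have hWlen : W.length ≤ P₁.eval x.length := by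
      have hdesc : ∀ c ∈ ds, c.length ≤ Dm.eval x.length := by
        intro c hc
        rw [List.mem_ofFn] at hc
        obtain ⟨i, rfl⟩ := hc
        have hi : (i : ℕ) ≤ N := Nat.lt_succ_iff.1 i.isLt
        have h1 := length_desc_le (C i)
        have h2 : (C i).size ≤ s.eval (i : ℕ) := (hC i).2
        have h3 : s.eval (i : ℕ) ≤ s.eval N := TM2Iter.eval_mono s hi
        have hD : Dm.eval x.length = (s.eval N + 1) * (8 * (N + s.eval N) + 10) := by
          simp [hDm, hN, eval_comp]
        rw [hD]
        exact h1.trans (Nat.mul_le_mul (by omega) (by omega))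
      have := PRelSigPi.length_body_le hdesc
      have hlen : ds.length = N + 1 := List.length_ofFn
      rw [hlen] at this
      have hP : P₁.eval x.length = (N + 1) * (2 * Dm.eval x.length + 2) := by simp [hP₁, hN]
      rw [hP]
      exact this
    refine ⟨W, hWlen, fun u _ => ?_⟩
    -- the matrix for the challenge `u`
    intro hu
    simp only [xY_apply, sndP_boolPair] at hu
    rw [instFn_apply, certFn_apply]
    have hx' : boolPair x u ∈ E := (hp x).1 hx u hu
    obtain ⟨v, hv, hvR⟩ := (hq _).1 hx'
    have h0 : boolPair (boolPair x u) [] ∈ PrefixLang R q :=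
      (boolPair_mem_PrefixLang R q _ _).2 ⟨v, by simpa using hv, by simpa using hvR⟩
    have hWq : ∀ v : List Bool, v.length ≤ q.eval (boolPair x u).length →
        (Answer W (boolPair (boolPair x u) v) ↔ boolPair (boolPair x u) v ∈ PrefixLang R q) := by
      intro v hv
      apply hAns
      have hmono : q.eval (2 * x.length + 2 + u.length) ≤ q.eval (2 * x.length + 2 + p.eval x.length) :=
        TM2Iter.eval_mono q (by omega)
      simp only [length_boolPair] at hv ⊢
      omega
    obtain ⟨v', hext, hv'len, hv'R⟩ := extractFn_spec R q (boolPair x u) W hWq h0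
    rw [hext, sndP_boolPair]
    exact ⟨hv'len, hv'R⟩
  · -- soundness: a verified certificate is conclusive
    rintro ⟨W, -, hB⟩
    rw [hp x]
    intro u hu
    have hu' : u.length ≤ p.eval (boolPair x W).length :=
      hu.trans (TM2Iter.eval_mono p (by simp only [length_boolPair]; omega))
    have hM := hB u hu'
    change (sndP _).length ≤ p.eval (xY _).length → _ at hM
    rw [xY_apply, sndP_boolPair, instFn_apply] at hM
    obtain ⟨hlen, hvR⟩ := hM hu
    exact (hq _).2 ⟨_, hlen, hvR⟩

/-- **The Karp–Lipton theorem** `NP ⊆ P/poly → PH = Σ₂ᵖ` (Karp–Lipton 1980, Thm. 6.1, with Sipser's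
improvement from `Σ₃ᵖ` to `Σ₂ᵖ`; Arora–Barak 2009, Thm. 6.19): `Π₂ᵖ ⊆ Σ₂ᵖ`
(`PiP_two_subset_SigmaP_two`) and the collapse (`PH_eq_SigmaP_two_of_PiP_two_subset`).
[cite: KarpLipton1980, Thm. 6.1] -/
theorem PH_eq_SigmaP_two_of_NP_subset_PPoly (hNP : Nondeterministic.NP ⊆ PPoly) : PH = SigmaP 2 :=
  PH_eq_SigmaP_two_of_PiP_two_subset (PiP_two_subset_SigmaP_two hNP)

end KarpLipton

end Literature.Computability.Complexity

/-- **Discharge of `Literature.Computability.Complexity.karp_lipton`** (pnp.S15; Karp–Lipton 1980, Thm. 6.1; Arora–Barak 2009,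
Thm. 6.19): `NP ⊆ P/poly → PH = Σ₂ᵖ`. [cite: KarpLipton1980, Thm. 6.1] -/
theorem Literature.Computability.Complexity.karp_lipton_holds : Literature.Computability.Complexity.karp_lipton :=
  fun h => Literature.Computability.Complexity.KarpLipton.PH_eq_SigmaP_two_of_NP_subset_PPoly h
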